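import Literature.Barriers.NavierStokesRegularity.BuckmasterVicolNonuniquenessProofs
import Literature.Barriers.NavierStokesRegularity.BuckmasterVicolNonuniquenessLimit
import Literature.Analysis.FunctionSpaces.TorusWeakFormBookkeeping
import HarnessLib

/-!
# Buckmaster–Vicol 2019, Thm. 1.2 — proof architecture, III: Prop. 2.1 (the main iteration) as a
  named fact, and the proved assembly of §2.4

Sibling proof file of the barrier entry
`Literature/Barriers/NavierStokesRegularity/BuckmasterVicolNonuniqueness` (D-0021), completing the
decomposition of the `provefact` programme for `BuckmasterVicolNonuniqueness`:

* `BuckmasterVicol2019_prop21` — **Prop. 2.1 of Buckmaster–Vicol 2019 as printed** (the iterative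
  proposition of the intermittent convex-integration scheme, with the energy profile `e` and the
  inductive estimates (2.2)–(2.6) of §2.2, on the tree's unit torus): named fact, the XL core
  (§§3–6 of the paper: intermittent Beltrami flows, the perturbation and its correctors, the new
  Reynolds stress, the energy iterate), not formalised; its docstring carries a review seat's
  analysis of the printed proof (the energy iterate of §6 for an arbitrary input triple, the
  smoothness of the amplitudes, the derivative part of (2.4)) and of what a discharge needs on
  top of the tree's proved energy-free step (`Literature.Barriers.AnomalousDissipation.jstage_step`,
  files `Analysis/FluidPDE/Jet*`).
* `BuckmasterVicol2019_thm12_of_prop21` — **proved**: Prop. 2.1 implies Thm. 1.2 as printed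
  (`BuckmasterVicol2019_thm12` of part I), i.e. the half page §2.4 of the paper in Lean: the
  choice of `a` (`|e(t)| ≤ δ₁/100`), the start from the zero triple, the iteration, the
  interpolation `L²/H¹` of the increments (part II), the `C⁰_t L²_x`/`C⁰_t H^{β'}_x` limit (a.e.
  pointwise `limUnder`, Fatou tail bounds, part II), the weak formulation in the limit from the
  Navier–Stokes–Reynolds weak identity with defect `∫∫ R̊_q : ∇ψ → 0` (the tree's proved
  `Torus.IsNSReynoldsOn.weak_identity` and part II's
  `isWeakNSSolutionOn_of_tendsto_L2_of_defect`), zero mean and the energy identity in the limit.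
* `BuckmasterVicolNonuniqueness_of_prop21` — the catalogued barrier from Prop. 2.1 alone (through
  part I's scaling step).

## References

* T. Buckmaster, V. Vicol, *Nonuniqueness of weak solutions to the Navier–Stokes equation*,
  Ann. of Math. 189 (2019), 101–144 = arXiv:1709.10033: §2.1 (parameters `b, β, λ_q, δ_q`),
  §2.2 ((2.2)–(2.6) and footnote 3, the norms), Prop. 2.1 with (2.7) (§2.3, p. 5), §2.4 (proof
  of Thm. 1.2, pp. 5–6), Rem. 3.3 (`N_Λ`); §4.1–§4.4 and Lemmas 4.1–4.4 (pp. 10–13), §6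
  Lemmas 6.1–6.3 (pp. 20–21). [`BuckmasterVicol2019AnnMath`]
* T. Buckmaster, V. Vicol, *Convex integration and phenomenologies in turbulence*, EMS Surv.
  Math. Sci. 6 (2019), 173–263 = arXiv:1901.09023: §7 (the jet form of the scheme).
  [`BuckmasterVicol2020`]
-/

noncomputable section

open MeasureTheory Set Filter Function
open scoped ENNReal NNReal InnerProductSpace Topology ContDiff

namespace Literature.Barriers.NavierStokesRegularity

open Literature.Analysis.FunctionSpaces Literature.Analysis.FluidPDE
open Literature.Barriers.AnomalousDissipation Literature.Barriers.AnomalousDissipation.BV2019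

/-- The flat three-torus `T³ = (ℝ/ℤ)³` (local notation). -/
local notation "𝕋³" => UnitAddTorus (Fin 3)
/-- Velocity values (local notation). -/
local notation "ℝ³" => EuclideanSpace ℝ (Fin 3)

/-! ## Prop. 2.1 as printed (named fact) -/

/-- **Buckmaster–Vicol 2019, Prop. 2.1 (the main iteration) with (2.7) — named fact, as printed.**

*Printed* (arXiv:1709.10033). §2, p. 4: "For every integer `q ≥ 0` we will construct a solution
`(v_q, p_q, R̊_q)` to the Navier-Stokes-Reynolds system (2.1) `∂ₜv_q + div (v_q ⊗ v_q) + ∇p_q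
- νΔv_q = div R̊_q`, `div v_q = 0`. where the Reynolds stress `R̊_q` is assumed to be a trace-free
symmetric matrix." §2.1: "we fix a sufficiently large, universal constant `b ∈ 16ℕ`, and
depending on `b` we fix a regularity parameter `β > 0` such that `βb² ≤ 4` and `βb ≤ 1/40` …
`λ_q = a^{(b^q)}`, `δ_q = λ_1^{3β} λ_q^{-2β}` for some integer `a ≫ 1` to be chosen suitably."
§2.2 (footnote 3: `‖f‖_{L^p} = ‖f‖_{L^∞_t L^p_x}`, `‖f‖_{C^N_{x,t}} = ∑_{0≤n+|α|≤N} ‖∂ₜⁿ D^α f‖_{L^∞}`):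
"(2.2) `‖v_q‖_{C¹_{x,t}} ≤ λ_q⁴`, (2.3) `‖R̊_q‖_{L¹} ≤ λ_q^{-ε_R} δ_{q+1}`, (2.4)
`‖R̊_q‖_{C¹_{x,t}} ≤ λ_q^{10}`. We additionally assume (2.5) `0 ≤ e(t) - ∫_{T³}|v_q|² dx ≤ δ_{q+1}`
and (2.6) `e(t) - ∫_{T³}|v_q|² dx ≤ δ_{q+1}/100 ⇒ R̊_q(·,t) ≡ 0` for all `t ∈ [0,T]`." §2.3: "In
addition to the sufficiently large universal constant `b`, and the sufficiently small regularity
parameter `β = β(b) > 0` fixed earlier, we fix the constant `M_e = ‖e‖_{C¹_t}`. … **Proposition 2.1.**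
There exists a universal constant `M > 0`, a sufficiently small parameter `ε_R = ε_R(b,β) > 0`
and a sufficiently large parameter `a₀ = a₀(b, β, ε_R, M, M_e) > 0` such that for any integer
`a ≥ a₀`, which is a multiple of the `N_Λ` of Remark 3.3, the following holds: Let `(v_q, p_q, R̊_q)`
be a triple solving the Navier-Stokes-Reynolds system (2.1) in `T³ × [0,T]` satisfying the
inductive estimates (2.2)–(2.6). Then there exists a second triple `(v_{q+1}, p_{q+1}, R̊_{q+1})`
solving (2.1) and satisfying the (2.2)–(2.6) with `q` replaced by `q+1`. In addition we have
that (2.7) `‖v_{q+1} - v_q‖_{L²} ≤ M δ_{q+1}^{1/2}`." §1, p. 2: "We consider solutions normalized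
to have zero spatial mean … The constant `ν ∈ (0,1]` is the kinematic viscosity".

*Transcription* (unit torus `T³ = (ℝ/ℤ)³` with probability Haar measure, the normalisation of
the tree; the paper prints `T³ = ℝ³/2πℤ³` — what is used is that the proof of §§3–6 is
insensitive to the period, all constants below being existential): there are `b ∈ 16ℕ`,
`β > 0` with `βb² ≤ 4`, `βb ≤ 1/40` (the fixed parameters of §2.1), `M > 0`, `ε_R > 0` and
`N_Λ ≥ 1` such that for every viscosity `ν ∈ (0,1]`, every `T > 0`
and every profile `e` smooth and nonnegative on `[0,T]` (the profile of Thm. 1.2, fixed in §2;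
only `M_e = ‖e‖_{C¹}` enters `a₀`, here `a₀` may depend on `ν, T, e` — weaker) there is `a₀` such
that for every integer `a ≥ a₀` divisible by `N_Λ` and every level `q`: every classical
Navier–Stokes–Reynolds triple `(v, p, R)` on `[0,T] × T³` (accepted `Torus.IsNSReynoldsOn`: jointly
smooth, `R` symmetric and trace free by columns, `p` mean free) with `v` of zero mean, obeying
(2.2)–(2.4) at level `q` in the accepted renderings `BV2019.C1xtLE` (sum of the sup norms of
`f, ∂ᵢf, ∂ₜf` on `[0,T] × T³`, footnote 3) and `BV2019.L1LE` (`sup_t ∫ ‖R(t)‖`, pointwise norm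
the maximal column norm), with `λ_q = BV2019.freq a b q`, `δ_q = BV2019.amp β a b q`, and the
energy hypotheses (2.5), (2.6) with respect to `e` (`∫|v_q|²` the Bochner integral of `‖v(t,x)‖²`),
admits a successor triple with the same properties at level `q+1` and
`‖v_{q+1}(t) - v_q(t)‖_{L²(T³)} ≤ M δ_{q+1}^{1/2}` for all `t ∈ [0,T]` (2.7).
The proof (§§3–6: intermittent Beltrami flows §3, the perturbation §4, the Reynolds stress §5,
the energy iterate §6) is not formalised. See `BuckmasterVicol2019_thm12_of_prop21` for what the
fact yields (Thm. 1.2, by the argument of §2.4, proved).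

*Relation to* `Literature.Barriers.AnomalousDissipation.BuckmasterVicol2019_iterationFromLevel`
(`Barriers/AnomalousDissipation/ConvexIntegrationNonLerayProofs`, the form of Prop. 2.1 + §2.4 that
the printed proof of Thm. 1.3 invokes in §2.5; since proved in the tree,
`Literature.Barriers.AnomalousDissipation.BuckmasterVicol2019_iterationFromLevel_holds`, by the jet
scheme of [cite: BuckmasterVicol2020, §7] — `JetStep.jet_step`, `JetStep.StepPars.step_arith`,
`Literature.Barriers.AnomalousDissipation.jstage_step`, files `Analysis/FluidPDE/Jet*`): the two
transcriptions are different slices of the same printed proposition and, as transcribed, NEITHER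
implies the other — that fact carries no energy profile (no (2.5)–(2.6), no energy identity in
the limit) but has `a₀` uniform in the starting level and triple, whereas here `a₀` may depend
on `(ν, T, e)` (printed: `a₀(b,β,ε_R,M,M_e)` with `M_e = ‖e‖_{C¹_t}`), which §2.5 cannot meet
(there `e` depends on `a`). A common parent would be Prop. 2.1 with the printed dependence
`a₀(M_e)` made explicit; it is not vendored (D-0026).

*Analysis of the printed proof* (review-split seat, 2026-08-17, with pp. 10–13 and 20–21 of the
held arXiv text open; page numbers are those of that copy, as elsewhere in this file. This is
commentary for a future discharge — the statement below is the printed one, unchanged; the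
in-place restatement p140006 was declined in review for exactly that reason.)
(A1) *The energy iterate for an arbitrary input triple.* In the case `ρ₀(t) = 0` (Lemma 6.3,
p. 20: "If `ρ₀(t) = 0` then `w_{q+1}(·,t) ≡ 0`, `R̊_q(·,t) ≡ 0`, `R̊_{q+1}(·,t) ≡ 0` and
`e(t) - ∫|v_{q+1}|² ≤ 3δ_{q+2}/4`") the proof writes
"`e(t) - ∫_{T³}|v_{q+1}(x,t)|² = e(t) - ∫_{T}|v_q(x,t)|²`" (p. 21), whereas
`v_{q+1}(·,t) = v_ℓ(·,t)` is the space–time mollification of `v_q` of §4.1 (p. 10). By the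
estimate `|∫|v_q|² - ∫|v_ℓ|²| ≲ λ_q⁸ℓ` in the proof of Lemma 6.2 (p. 20) the printed upper bound
survives, but the lower bound `0 ≤ e(t) - ∫|v_{q+1}|²` of (2.5) at level `q+1` is proved nowhere
in this case, and for the constructed `v_{q+1} = v_ℓ` it fails on admissible inputs: `R̊_q ≡ 0`,
`e = ∫|v_q|²` with `v_q = c₀e^{-ν(2πk)²t} U_k` a viscously decaying shear mode and `2πkν` large —
then `ρ₀ ≡ 0`, `w_{q+1} ≡ 0`, and at each `t` the time mollification raises the energy above
`e(t)` by more than the space mollification lowers it. (The printed statement, existential in the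
successor, is not refuted by this: there the input triple itself is an admissible successor.)
Two remedies, neither printed. (i) *Along the iteration of §2.4* (start `v₀ ≡ 0`) the invariant
"`e(t) - ∫|v_q(t)|² ≤ δ_{q+1}/100 ⇒ v_q(·,t) ≡ 0`" holds and makes the displayed identity true:
`ρ₀(t) = 0` forces `ρ ≡ 0` on `(t-ℓ, t+ℓ)`, hence (p. 21, first two displays, with Lemma 4.3)
`e - ∫|v_q|² ≤ δ_{q+2}/2 + Cλ_q^{-ε_R}δ_{q+1} ≤ δ_{q+1}/100` there, hence by the invariant and (2.6)
`v_q ≡ 0`, `R̊_q ≡ 0` on `(t-ℓ, t+ℓ)`, so `v_ℓ(·,t)`, `R̊_ℓ(·,t)` vanish (to infinite order in `t`),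
`w_{q+1}(·,t) ≡ 0`, `v_{q+1}(·,t) ≡ 0`, `R̊_{q+1}(·,t) ≡ 0` and
`e(t) - ∫|v_{q+1}(t)|² = e(t) = e(t) - ∫|v_q(t)|² ∈ [0, δ_{q+2}/2]`, while where `ρ₀(t) ≠ 0`
Lemma 6.2 gives `e - ∫|v_{q+1}|² ∈ [δ_{q+2}/4, 3δ_{q+2}/4]`; so the invariant propagates and the
printed proof of Thm. 1.2 stands. (ii) *For the fact as printed* (arbitrary input) a discharge
glues in time: with `g = e - ∫|v_q|²` (smooth, `|g'| ≤ M_e + 2λ_q⁸`) and a smooth `θ = ϑ(g/δ_{q+2})`,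
`ϑ = 0` below `1/8`, `ϑ = 1` above `1/4`, take `v_{q+1} = v_q + θ(v_ℓ - v_q) + w_{q+1}`. On
`{θ < 1} ⊂ {g < δ_{q+2}/4}` and its `ℓ`-neighbourhood (2.6) gives `R̊_q ≡ 0`, so there `R̊_ℓ ≡ 0`,
`ρ₀ ≡ 0`, `w_{q+1} ≡ 0`, and the new stress is
`θR̃_commutator - θ(1-θ)(v_ℓ - v_q) ⊗̊ (v_ℓ - v_q) + ℛ(θ'(v_ℓ - v_q))`, of size `≲ ℓλ_q⁸` in `C⁰`
for the first two terms and `≲ λ_q^{20}ℓ` in `L¹` for the last (`|θ'| ≲ λ_q⁸/δ_{q+2} ≤ λ_q^{16}`,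
`‖v_ℓ - v_q‖_{L^∞} ≲ ℓλ_q⁴`, `ℛ` bounded on `L²`), below `λ_{q+1}^{-ε_R}δ_{q+2}/2` as soon as
`ℓ ≤ λ_q^{-29-ε_R b}` (the printed `ℓ = λ_q^{-20}` of §4.3 is then replaced by a smaller power,
compatible with the lower constraint `ℓ ≫ (σλ_{q+1})^{-1/2} = λ_q^{-b/32}` of §4.1 for `b` large; the
jet scheme of the tree has `ℓ = λ_{q+1}^{-1/16}`); on `{θ = 0} = {g ≤ δ_{q+2}/8}` the successor is the
input triple (`R̊_{q+1} = R̊_q = 0`, gap `g ∈ [0, δ_{q+2}/8]`), on `{0 < θ < 1}` the gap is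
`g ± Cℓλ_q⁸ ∈ (δ_{q+2}/100, δ_{q+2}]`, and on `{θ = 1}` the construction and §§5–6 are the printed
ones (where `ρ₀ = 0` there, `v_{q+1} = v_ℓ` and the gap is `≥ δ_{q+2}/4 - Cℓλ_q⁸ > 0`).
(A2) *Smoothness of the amplitudes.* `a_(ξ) = ρ₀^{1/2} χ₀ γ_ξ(…)` (§4.3) with `ρ₀ = ρ *_t φ_ℓ`,
`ρ = c·max(ẽ - δ_{q+2}/2, 0)` (§4.4) is not smooth in `t` at the zeros of `ρ₀`, although the third
bound of Lemma 4.4 is asserted for `i = 0` too ("For `i = 0`, the time derivative may land on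
`ρ₀`, and we use in addition … to estimate similarly", p. 13) and the successor must be a smooth
triple; a formal proof mollifies a Lipschitz square root of `ρ` instead (energy error `≲ ℓ^{1/2}`-small).
(A3) *The derivative part of (2.4).* It enters the printed proof only through
`‖R̊_ℓ‖_{C^N_{t,x}} ≲ λ_q^{10}ℓ^{-N+1} ≲ ℓ^{-N}` (§4.1, p. 10, and the proofs of Lemmas 4.1, 4.2, 4.4,
pp. 12–13), where the `C⁰` bound would give `ℓ^{-N-1}` and serve equally; in the conclusion it
requires `C⁰` bounds on `∂ₜR̊_{q+1}`, `∂ᵢR̊_{q+1}` (crude: every term of §5 is explicit), which the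
tree's energy-free step (`JStage.supR`) does not record.
(A4) *Size of a discharge on top of the tree's `Jet*` files* (`JetStep.jet_step`: mollified
triple, intermittent jets, `w = w^{(p)} + w^{(c)} + w^{(t)}`, new stress through `ℛ`, with
`L²`-increment, `L¹`/`C⁰`-stress and `C¹`-velocity bounds, all parameters symbolic): an amplitude
with a time-dependent pumping factor vanishing exactly where the profile is met (§4.4, with (A2)),
the two-sided energy identity `|∫|w^{(p)}|² - 3∑ρᵢ∫χᵢ²| ≤ ℓ^{1/2}` and the cross terms of the proof
of Lemma 6.2 (p. 20), the gluing (A1)(ii), the derivative bounds (A3), and the level `q = 0`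
(`δ₁ = λ₁^β > 1`; `jstage_step` is stated for `q ≥ 1`) — several thousand lines; not attempted
by the review seat.
[cite: BuckmasterVicol2019AnnMath, Prop. 2.1 and (2.2)–(2.7), §2.1–§2.3 p. 4–5; §1 p. 2; §2.5 p. 6; §4.1, §4.3, §4.4 and Lemmas 4.1–4.4 pp. 10–13; Lemmas 6.2, 6.3 pp. 20–21] -/
def BuckmasterVicol2019_prop21 : Prop :=
  ∃ b : ℕ, 16 ∣ b ∧ 0 < b ∧
  ∃ β : ℝ, 0 < β ∧ β * (b : ℝ) ^ 2 ≤ 4 ∧ β * b ≤ 1 / 40 ∧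
  ∃ M : ℝ, 0 < M ∧ ∃ εR : ℝ, 0 < εR ∧ ∃ NΛ : ℕ, 0 < NΛ ∧
  ∀ ν : ℝ, 0 < ν → ν ≤ 1 → ∀ T : ℝ, 0 < T →
  ∀ e : ℝ → ℝ, ContDiffOn ℝ ∞ e (Icc 0 T) → (∀ t ∈ Icc 0 T, 0 ≤ e t) →
  ∃ a₀ : ℕ, ∀ a : ℕ, a₀ ≤ a → NΛ ∣ a → ∀ q : ℕ,
  ∀ (v : ℝ → 𝕋³ → ℝ³) (p : ℝ → 𝕋³ → ℝ) (R : ℝ → 𝕋³ → Fin 3 → ℝ³),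
    Torus.IsNSReynoldsOn (Icc 0 T) ν v p R →
    (∀ t ∈ Icc 0 T, Torus.HasZeroMean (v t)) →
    C1xtLE T v ((freq a b q : ℝ) ^ 4) →
    L1LE T R ((freq a b q : ℝ) ^ (-εR) * amp β a b (q + 1)) →
    C1xtLE T R ((freq a b q : ℝ) ^ 10) →
    (∀ t ∈ Icc 0 T, 0 ≤ e t - ∫ x, ‖v t x‖ ^ 2 ∧ e t - ∫ x, ‖v t x‖ ^ 2 ≤ amp β a b (q + 1)) →
    (∀ t ∈ Icc 0 T, e t - ∫ x, ‖v t x‖ ^ 2 ≤ amp β a b (q + 1) / 100 → ∀ x, R t x = 0) →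
    ∃ (v' : ℝ → 𝕋³ → ℝ³) (p' : ℝ → 𝕋³ → ℝ) (R' : ℝ → 𝕋³ → Fin 3 → ℝ³),
      Torus.IsNSReynoldsOn (Icc 0 T) ν v' p' R' ∧
      (∀ t ∈ Icc 0 T, Torus.HasZeroMean (v' t)) ∧
      C1xtLE T v' ((freq a b (q + 1) : ℝ) ^ 4) ∧
      L1LE T R' ((freq a b (q + 1) : ℝ) ^ (-εR) * amp β a b (q + 2)) ∧
      C1xtLE T R' ((freq a b (q + 1) : ℝ) ^ 10) ∧
      (∀ t ∈ Icc 0 T, 0 ≤ e t - ∫ x, ‖v' t x‖ ^ 2 ∧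
        e t - ∫ x, ‖v' t x‖ ^ 2 ≤ amp β a b (q + 2)) ∧
      (∀ t ∈ Icc 0 T, e t - ∫ x, ‖v' t x‖ ^ 2 ≤ amp β a b (q + 2) / 100 → ∀ x, R' t x = 0) ∧
      ∀ t ∈ Icc 0 T, eLpNorm (v' t - v t) 2 volume ≤
        ENNReal.ofReal (M * amp β a b (q + 1) ^ (1 / 2 : ℝ))

/-! ## The stages of the iteration (the inductive hypotheses (2.2)–(2.6), bundled) -/

/-- A **stage of the Buckmaster–Vicol iteration at level `q`**: a classical Navier–Stokes–Reynolds
triple `(v, p, R)` on `[0,T] × T³` with `v` of zero mean obeying the inductive estimates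
(2.2)–(2.6) of BV19 §2.2 at level `q` for the profile `e` and the parameters `ν, ε_R, β, a, b`
(exactly the hypotheses of `BuckmasterVicol2019_prop21` at level `q`). A bookkeeping device for
the proof of `BuckmasterVicol2019_thm12_of_prop21`.
[cite: BuckmasterVicol2019AnnMath, §2.2 (2.2)–(2.6)] -/
structure BVStage (ν T : ℝ) (e : ℝ → ℝ) (εR β : ℝ) (a b q : ℕ) where
  /-- The velocity `v_q`. -/
  v : ℝ → 𝕋³ → ℝ³
  /-- The pressure `p_q`. -/
  p : ℝ → 𝕋³ → ℝ
  /-- The Reynolds stress `R̊_q` (by columns). -/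
  R : ℝ → 𝕋³ → Fin 3 → ℝ³
  /-- `(v_q, p_q, R̊_q)` solves the Navier–Stokes–Reynolds system (2.1) on `[0,T] × T³`. -/
  nsr : Torus.IsNSReynoldsOn (Icc 0 T) ν v p R
  /-- Zero spatial mean of the velocity. -/
  mean : ∀ t ∈ Icc 0 T, Torus.HasZeroMean (v t)
  /-- (2.2) `‖v_q‖_{C¹_{x,t}} ≤ λ_q⁴`. -/
  c1v : C1xtLE T v ((freq a b q : ℝ) ^ 4)
  /-- (2.3) `‖R̊_q‖_{L¹} ≤ λ_q^{-ε_R} δ_{q+1}`. -/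
  l1R : L1LE T R ((freq a b q : ℝ) ^ (-εR) * amp β a b (q + 1))
  /-- (2.4) `‖R̊_q‖_{C¹_{x,t}} ≤ λ_q^{10}`. -/
  c1R : C1xtLE T R ((freq a b q : ℝ) ^ 10)
  /-- (2.5) `0 ≤ e(t) - ∫|v_q|² ≤ δ_{q+1}` on `[0,T]`. -/
  energy : ∀ t ∈ Icc 0 T, 0 ≤ e t - ∫ x, ‖v t x‖ ^ 2 ∧ e t - ∫ x, ‖v t x‖ ^ 2 ≤ amp β a b (q + 1)
  /-- (2.6) `e(t) - ∫|v_q|² ≤ δ_{q+1}/100 ⇒ R̊_q(·,t) ≡ 0`. -/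
  zeroR : ∀ t ∈ Icc 0 T, e t - ∫ x, ‖v t x‖ ^ 2 ≤ amp β a b (q + 1) / 100 → ∀ x, R t x = 0

namespace BVStage

variable {ν T : ℝ} {e : ℝ → ℝ} {εR β : ℝ} {a b : ℕ}

/-- Running the iteration: from a stage at level `0` and a step map, the stage at level `q`.
[folklore] -/
def iterate (S₀ : BVStage ν T e εR β a b 0)
    (step : ∀ q, BVStage ν T e εR β a b q → BVStage ν T e εR β a b (q + 1)) :
    ∀ q, BVStage ν T e εR β a b q
  | 0 => S₀
  | q + 1 => step q (iterate S₀ step q)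

/-- The successor stage is the step applied to the current one. [folklore] -/
theorem iterate_succ (S₀ : BVStage ν T e εR β a b 0)
    (step : ∀ q, BVStage ν T e εR β a b q → BVStage ν T e εR β a b (q + 1)) (q : ℕ) :
    iterate S₀ step (q + 1) = step q (iterate S₀ step q) :=
  rfl

end BVStage

/-! ## Parameter bookkeeping (§2.1, §2.4) -/

section Parameters

/-- **Geometric domination of `λ_n^{-κ}`**: `λ_n^{-κ} ≤ (a^{-κ})^n` for `a ≥ 1`, `b ≥ 2`, `κ ≥ 0`
(`λ_n = a^{(b^n)}`, `b^n ≥ n` — Mathlib's `Nat.lt_pow_self`). [folklore] -/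
theorem freq_rpow_neg_le_pow {a b : ℕ} (ha : 1 ≤ a) (hb : 2 ≤ b) {κ : ℝ} (hκ : 0 ≤ κ) (n : ℕ) :
    (freq a b n : ℝ) ^ (-κ) ≤ ((a : ℝ) ^ (-κ)) ^ n := by
  have ha1 : (1 : ℝ) ≤ a := by exact_mod_cast ha
  have ha0 : (0 : ℝ) ≤ a := zero_le_one.trans ha1
  rw [freq_real, ← Real.rpow_mul ha0, ← Real.rpow_mul_natCast ha0]
  refine Real.rpow_le_rpow_of_exponent_le ha1 ?_
  have hnat : n ≤ b ^ n := (Nat.lt_pow_self (by omega)).le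
  have h : (n : ℝ) ≤ ((b ^ n : ℕ) : ℝ) := by exact_mod_cast hnat
  nlinarith

/-- **Summability of `K λ_{n+m}^{-κ}`** in `[0,∞]` for `a ≥ 2`, `b ≥ 2`, `κ > 0`: the series is
dominated by a geometric series of ratio `a^{-κ} < 1`. [folklore] -/
theorem tsum_ofReal_mul_freq_rpow_neg_ne_top {a b : ℕ} (ha : 2 ≤ a) (hb : 2 ≤ b) {κ : ℝ}
    (hκ : 0 < κ) (K : ℝ) (m : ℕ) :
    ∑' n : ℕ, ENNReal.ofReal (K * (freq a b (n + m) : ℝ) ^ (-κ)) ≠ ⊤ := by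
  have ha1 : 1 ≤ a := le_trans one_le_two ha
  have haR : (1 : ℝ) < a := by exact_mod_cast lt_of_lt_of_le one_lt_two ha
  set r : ℝ := (a : ℝ) ^ (-κ) with hr
  have hr0 : 0 ≤ r := Real.rpow_nonneg (by positivity) _
  have hr1 : r < 1 := Real.rpow_lt_one_of_one_lt_of_neg haR (by linarith)
  have hterm : ∀ n : ℕ, ENNReal.ofReal (K * (freq a b (n + m) : ℝ) ^ (-κ)) ≤
      ENNReal.ofReal |K| * ENNReal.ofReal r ^ n := by
    intro n
    rw [← ENNReal.ofReal_pow hr0, ← ENNReal.ofReal_mul (abs_nonneg K)]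
    refine ENNReal.ofReal_le_ofReal ?_
    have h1 : (freq a b (n + m) : ℝ) ^ (-κ) ≤ r ^ (n + m) := freq_rpow_neg_le_pow ha1 hb hκ.le _
    have h2 : r ^ (n + m) ≤ r ^ n := pow_le_pow_of_le_one hr0 hr1.le (Nat.le_add_right n m)
    have h3 : 0 ≤ (freq a b (n + m) : ℝ) ^ (-κ) := Real.rpow_nonneg (Nat.cast_nonneg _) _
    calc K * (freq a b (n + m) : ℝ) ^ (-κ) ≤ |K| * (freq a b (n + m) : ℝ) ^ (-κ) :=
          mul_le_mul_of_nonneg_right (le_abs_self K) h3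
      _ ≤ |K| * r ^ n := mul_le_mul_of_nonneg_left (h1.trans h2) (abs_nonneg K)
  refine ne_top_of_le_ne_top ?_ (ENNReal.tsum_le_tsum hterm)
  rw [ENNReal.tsum_mul_left, ENNReal.tsum_geometric]
  refine ENNReal.mul_ne_top ENNReal.ofReal_ne_top (ENNReal.inv_ne_top.2 ?_)
  exact (tsub_pos_of_lt (ENNReal.ofReal_lt_one.2 hr1)).ne'

/-- `δ_{q}^{1/2} = λ_1^{3β/2} λ_q^{-β}` for `a ≥ 1`. [folklore] -/
theorem amp_rpow_half (β : ℝ) (a b q : ℕ) :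
    amp β a b q ^ (1 / 2 : ℝ) = (freq a b 1 : ℝ) ^ (3 * β / 2) * (freq a b q : ℝ) ^ (-β) := by
  have h1 : (0 : ℝ) ≤ (freq a b 1 : ℝ) := Nat.cast_nonneg _
  have hq : (0 : ℝ) ≤ (freq a b q : ℝ) := Nat.cast_nonneg _
  rw [amp, Real.mul_rpow (Real.rpow_nonneg h1 _) (Real.rpow_nonneg hq _), ← Real.rpow_mul h1,
    ← Real.rpow_mul hq]
  congr 1 <;> congr 1 <;> ring

/-- `δ₁ = λ_1^β = a^{bβ}` (for `a ≥ 1`). [folklore] -/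
theorem amp_one_eq {a : ℕ} (ha : 1 ≤ a) (β : ℝ) (b : ℕ) : amp β a b 1 = (a : ℝ) ^ ((b : ℝ) * β) := by
  have ha0 : (0 : ℝ) ≤ a := Nat.cast_nonneg _
  have h0 : (0 : ℝ) < (freq a b 1 : ℝ) := freq_real_pos ha b 1
  rw [amp, ← Real.rpow_add h0, freq_real, ← Real.rpow_mul ha0, pow_one]
  congr 1
  ring

/-- **The `H^{β'}` increment as a single power** (the middle member of (2.9) with (2.7), (2.2)
inserted): `(M δ_{q}^{1/2})^{1-β'} (2λ_q⁴)^{β'} = M^{1-β'} 2^{β'} λ_1^{3β(1-β')/2} λ_q^{-(β(1-β') - 4β')}`.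
[cite: BuckmasterVicol2019AnnMath, §2.4 (2.9)] -/
theorem increment_rpow_eq {a : ℕ} (ha : 1 ≤ a) {M β β' : ℝ} (hM : 0 ≤ M) (hβ'0 : 0 ≤ β')
    (hβ'1 : β' ≤ 1) (b q : ℕ) :
    ENNReal.ofReal (M * amp β a b q ^ (1 / 2 : ℝ)) ^ (1 - β') *
        ENNReal.ofReal (2 * (freq a b q : ℝ) ^ 4) ^ β' =
      ENNReal.ofReal (M ^ (1 - β') * 2 ^ β' * (freq a b 1 : ℝ) ^ (3 * β / 2 * (1 - β')) *
        (freq a b q : ℝ) ^ (-(β * (1 - β') - 4 * β'))) := by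
  have hL : (0 : ℝ) < (freq a b 1 : ℝ) := freq_real_pos ha b 1
  have hq : (0 : ℝ) < (freq a b q : ℝ) := freq_real_pos ha b q
  have hamp : 0 ≤ amp β a b q ^ (1 / 2 : ℝ) := Real.rpow_nonneg (amp_pos β ha b q).le _
  rw [ENNReal.ofReal_rpow_of_nonneg (mul_nonneg hM hamp) (by linarith),
    ENNReal.ofReal_rpow_of_nonneg (by positivity) hβ'0, ← ENNReal.ofReal_mul (by positivity)]
  congr 1
  rw [amp_rpow_half, Real.mul_rpow hM (by positivity),
    Real.mul_rpow (Real.rpow_nonneg hL.le _) (Real.rpow_nonneg hq.le _), ← Real.rpow_mul hL.le,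
    ← Real.rpow_mul hq.le, Real.mul_rpow zero_le_two (pow_nonneg hq.le 4),
    show ((freq a b q : ℝ) ^ 4) ^ β' = (freq a b q : ℝ) ^ ((4 : ℝ) * β') by
      rw [← Real.rpow_natCast, ← Real.rpow_mul hq.le]; norm_num,
    show (-(β * (1 - β') - 4 * β')) = -β * (1 - β') + 4 * β' by ring, Real.rpow_add hq]
  ring

end Parameters

/-! ## The zero stage and small lemmas on the bound predicates -/

section Stages

variable {T : ℝ}

/-- Partial derivatives of the zero field vanish (cf. the twin `Torus.partialDeriv_zero_fun` of
`FluidPDE/DuchonRobertSymmTestFieldProofs`, outside this file's import closure; the time-derivative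
analogue is the in-closure simp lemma `Torus.timeDerivWithin_zero` of `FluidPDE/EulerReynolds`).
[folklore] -/
@[simp]
theorem partialDeriv_zero_field {F : Type*} [NormedAddCommGroup F] [NormedSpace ℝ F] (i : Fin 3)
    (x : 𝕋³) : Torus.partialDeriv i (fun _ : 𝕋³ => (0 : F)) x = 0 := by
  simp [Torus.partialDeriv, Torus.lineDeriv]

/-- The zero field satisfies `‖0‖_{C¹_{x,t}} ≤ B` for every `B ≥ 0`. [folklore] -/
theorem c1xtLE_zero {F : Type*} [NormedAddCommGroup F] [NormedSpace ℝ F] {B : ℝ} (hB : 0 ≤ B) :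
    C1xtLE T (fun (_ : ℝ) (_ : 𝕋³) => (0 : F)) B :=
  ⟨0, 0, fun _ => 0, fun _ _ _ => by simp, fun _ _ _ _ => by simp, fun _ _ _ => by simp,
    by simpa using hB⟩

/-- From `‖f‖_{C¹_{x,t}} ≤ B`: a sup bound `‖f(t,x)‖ ≤ B` and derivative bounds summing to `≤ B`,
all nonnegative. [folklore] -/
theorem c1xtLE_bounds {F : Type*} [NormedAddCommGroup F] [NormedSpace ℝ F] {f : ℝ → 𝕋³ → F}
    {B : ℝ} (h : C1xtLE T f B) (hT : 0 ≤ T) :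
    ∃ (B₀ : ℝ) (B₁ : Fin 3 → ℝ), 0 ≤ B₀ ∧ (∀ i, 0 ≤ B₁ i) ∧ B₀ + ∑ i, B₁ i ≤ B ∧
      (∀ t ∈ Icc 0 T, ∀ x, ‖f t x‖ ≤ B₀) ∧
      ∀ i, ∀ t ∈ Icc 0 T, ∀ x, ‖Torus.partialDeriv i (f t) x‖ ≤ B₁ i := by
  obtain ⟨B₀, B₂, B₁, h0, h1, h2, hs⟩ := h
  have hmem : (0 : ℝ) ∈ Icc 0 T := ⟨le_rfl, hT⟩
  have hB₀ : 0 ≤ B₀ := (norm_nonneg _).trans (h0 0 hmem 0)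
  have hB₁ : ∀ i, 0 ≤ B₁ i := fun i => (norm_nonneg _).trans (h1 i 0 hmem 0)
  have hB₂ : 0 ≤ B₂ := (norm_nonneg _).trans (h2 0 hmem 0)
  exact ⟨B₀, B₁, hB₀, hB₁, by linarith, h0, h1⟩

/-- `∂ᵢ (f - g) = ∂ᵢ f - ∂ᵢ g` for `C¹` functions on the torus (cf. the twin
`Torus.partialDeriv_sub_at` of `FluidPDE/Antidivergence`, outside this file's import closure).
[folklore] -/
theorem partialDeriv_sub {F : Type*} [NormedAddCommGroup F] [NormedSpace ℝ F] {f g : 𝕋³ → F}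
    (hf : Torus.IsContDiff 1 f) (hg : Torus.IsContDiff 1 g) (i : Fin 3) (x : 𝕋³) :
    Torus.partialDeriv i (f - g) x = Torus.partialDeriv i f x - Torus.partialDeriv i g x := by
  have h : f - g = f + (-1 : ℝ) • g := by
    funext y; simp [sub_eq_add_neg]
  rw [h, Torus.partialDeriv_add hf (hg.smul (-1)), Torus.partialDeriv_const_smul hg]
  simp [sub_eq_add_neg]

/-- `λ_q ≤ λ_{q+1}` (for `a ≥ 1`, `b ≥ 1`). [folklore] -/
theorem freq_le_freq_succ {a b : ℕ} (ha : 1 ≤ a) (hb : 1 ≤ b) (q : ℕ) :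
    (freq a b q : ℝ) ≤ (freq a b (q + 1) : ℝ) := by
  exact_mod_cast Nat.pow_le_pow_right ha (Nat.pow_le_pow_right hb (Nat.le_succ q))

/-- Telescoping in `H^s`: `‖g_{q+m} - g_q‖_{H^s} ≤ ∑_{i<m} H_{q+i}` from
`‖g_{n+1} - g_n‖_{H^s} ≤ H_n` (integrable `g_n`; the triangle inequality
`Torus.eSobolevNorm_add_le_holds`). [folklore] -/
theorem eSobolevNorm_sub_le_sum_of_le {s : ℝ} {g : ℕ → 𝕋³ → EuclideanSpace ℂ (Fin 3)}
    (hg : ∀ n, Integrable (g n) volume) {H : ℕ → ℝ≥0∞}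
    (hH : ∀ n, Torus.eSobolevNorm s (g (n + 1) - g n) ≤ H n) (q m : ℕ) :
    Torus.eSobolevNorm s (g (q + m) - g q) ≤ ∑ i ∈ Finset.range m, H (q + i) := by
  induction m with
  | zero => simp
  | succ m ih =>
    have hsplit : g (q + (m + 1)) - g q = (g (q + m + 1) - g (q + m)) + (g (q + m) - g q) := by
      rw [← add_assoc]; abel
    rw [hsplit, Finset.sum_range_succ]
    calc Torus.eSobolevNorm s ((g (q + m + 1) - g (q + m)) + (g (q + m) - g q))
        ≤ Torus.eSobolevNorm s (g (q + m + 1) - g (q + m)) +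
            Torus.eSobolevNorm s (g (q + m) - g q) :=
          Torus.eSobolevNorm_add_le_holds ((hg _).sub (hg _)) ((hg _).sub (hg _))
      _ ≤ H (q + m) + ∑ i ∈ Finset.range m, H (q + i) := add_le_add (hH _) ih
      _ = _ := add_comm _ _

/-- Clamping time to `[0,T]` turns a field with space–time lift continuous on `[0,T] × ℝ³` into a
field jointly continuous on `ℝ × T³`. [folklore] -/
theorem continuous_uncurry_clamp_of_continuousOn (hT : (0 : ℝ) ≤ T) {u : ℝ → 𝕋³ → ℝ³}
    (hu : ContinuousOn (Torus.stLift u) (Icc 0 T ×ˢ univ)) :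
    Continuous (uncurry fun t x => u (projIcc 0 T hT t) x) := by
  refine Torus.continuous_uncurry_of_continuous_stLift ?_
  have h : Torus.stLift (fun t x => u (projIcc 0 T hT t) x) =
      Torus.stLift u ∘ fun p : ℝ × EuclideanSpace ℝ (Fin 3) => ((projIcc 0 T hT p.1 : ℝ), p.2) := by
    funext p; rfl
  rw [h]
  exact hu.comp_continuous
    ((continuous_subtype_val.comp (continuous_projIcc.comp continuous_fst)).prodMk continuous_snd)
    fun p => ⟨(projIcc 0 T hT p.1).2, mem_univ _⟩

/-- `∫ ‖f‖ ≤ ‖f‖_{L²}` on the probability space `T³` (as a real number, for `‖f‖_{L²} < ∞`).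
[folklore] -/
theorem integral_norm_le_toReal_eLpNorm_two {f : 𝕋³ → ℝ³} (hf : AEStronglyMeasurable f volume)
    (h2 : eLpNorm f 2 volume ≠ ⊤) : ∫ x, ‖f x‖ ≤ (eLpNorm f 2 volume).toReal := by
  rw [integral_norm_eq_lintegral_enorm hf]
  refine ENNReal.toReal_mono h2 ?_
  rw [← eLpNorm_one_eq_lintegral_enorm]
  simpa using eLpNorm_le_eLpNorm_mul_rpow_measure_univ (p := 1) (q := 2) (μ := volume)
    (by norm_num) hf

/-- `∫ ‖f‖² = (‖f‖²_{L²}).toReal` for every a.e. strongly measurable field (both sides vanish when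
`f ∉ L²`). [folklore] -/
theorem integral_norm_sq_eq_toReal {f : 𝕋³ → ℝ³} (hf : AEStronglyMeasurable f volume) :
    ∫ x, ‖f x‖ ^ 2 = (eLpNorm f 2 volume ^ 2).toReal := by
  rw [eLpNorm_two_sq_eq_lintegral,
    integral_eq_lintegral_of_nonneg_ae (ae_of_all _ fun x => sq_nonneg _) (hf.norm.pow 2)]
  congr 1
  refine lintegral_congr fun x => ?_
  rw [← ofReal_norm, ENNReal.ofReal_pow (norm_nonneg _)]

end Stages

/-! ## The assembly: Thm. 1.2 from Prop. 2.1 (the argument of §2.4) -/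

section Assembly

/-- **Buckmaster–Vicol 2019, Thm. 1.2 from Prop. 2.1** — the proof of §2.4, formalised. Given
`ν ∈ (0,1]`, take `β' = β/8` (any `0 < β' < β/(4+β)` would do; the printed `β/(8+β)`) as the
Sobolev exponent of the conclusion. For `T > 0` and a profile `e`: choose `a ≥ a₀`, a multiple
of `N_Λ`, `a ≥ 2`, so large that `sup_{[0,T]} e ≤ δ₁/100 = a^{bβ}/100` ("by taking `a` sufficiently
large … `|e(t)| ≤ … δ₁/100`"); then the zero triple is a stage at level `0` and Prop. 2.1 produces
stages `(v_q, p_q, R̊_q)` at all levels with `‖v_{q+1}(t) - v_q(t)‖_{L²} ≤ M δ_{q+1}^{1/2}`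
(summable, `δ_{q+1}^{1/2} = λ_1^{3β/2} λ_{q+1}^{-β}`). The limit `v(t,x) = lim_q v_q(t,x)` (a.e. and in
`L²`, with `‖v(t) - v_q(t)‖_{L²}` below the tail of the series, part II) is: jointly measurable;
a weak solution (`isWeakNSSolutionOn_of_tendsto_L2_of_defect`: the defect of `v_q` is
`∫∫ ∑ⱼ⟪R̊_q^{(j)}, ∂ⱼψ⟫` by `Torus.IsNSReynoldsOn.weak_identity`, bounded by
`C_ψ T λ_q^{-ε_R} δ_{q+1} → 0`); of zero mean; in `C⁰([0,T]; H^{β'})` (increments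
`‖v_{q+1} - v_q‖_{H^{β'}} ≤ ‖·‖_{L²}^{1-β'} ‖·‖_{H¹}^{β'} ≤ (Mδ_{q+1}^{1/2})^{1-β'} (2λ_{q+1}⁴)^{β'} =
K λ_{q+1}^{-γ}`, `γ = β(1-β') - 4β' > 0`, summable; the `H^{β'}` tail bound passes to the limit by
`eSobolevNorm_le_of_tendsto`, and continuity in time follows from that of the smooth `v_q` by an
`ε/3` argument); and `∫|v(t)|² = e(t)` (from (2.5): `e(t) - δ_{q+1} ≤ ∫|v_q(t)|² ≤ e(t)`).
[cite: BuckmasterVicol2019AnnMath, §2.4 (proof of Thm. 1.2)] -/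
theorem BuckmasterVicol2019_thm12_of_prop21 (hP : BuckmasterVicol2019_prop21) :
    BuckmasterVicol2019_thm12 := by
  intro ν hν hν1
  obtain ⟨b, hb16, hb0, β, hβ, hβb2, hβb, M, hM, εR, hεR, NΛ, hNΛ, hmain⟩ := hP
  have hb16' : 16 ≤ b := by obtain ⟨k, rfl⟩ := hb16; omega
  have hb2 : 2 ≤ b := by omega
  have hbR : (16 : ℝ) ≤ b := by exact_mod_cast hb16'
  have hβ4 : β < 4 := by nlinarith
  -- the Sobolev exponent of the conclusion and the decay exponent of the `H^{β'}` increments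
  set β' : ℝ := β / 8 with hβ'
  have hβ'0 : 0 < β' := by positivity
  have hβ'1 : β' ≤ 1 := by rw [hβ']; linarith
  set γ : ℝ := β * (1 - β') - 4 * β' with hγ
  have hγ0 : 0 < γ := by rw [hγ, hβ']; nlinarith
  refine ⟨β', hβ'0, fun T hT e he he0 => ?_⟩
  obtain ⟨a₀, ha₀⟩ := hmain ν hν hν1 T hT e he he0
  -- `sup_{[0,T]} e`
  obtain ⟨Emax, hEmax⟩ : ∃ E : ℝ, ∀ t ∈ Icc 0 T, e t ≤ E := by
    obtain ⟨E, hE⟩ := isCompact_Icc.bddAbove_image he.continuousOn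
    exact ⟨E, fun t ht => hE (mem_image_of_mem e ht)⟩
  -- the choice of `a`
  have hcast : Tendsto (fun a : ℕ => (a : ℝ)) atTop atTop := tendsto_natCast_atTop_atTop
  have E1 : ∀ᶠ a : ℕ in atTop, 100 * Emax ≤ (a : ℝ) ^ ((b : ℝ) * β) :=
    ((tendsto_rpow_atTop (by positivity)).comp hcast).eventually_ge_atTop _
  obtain ⟨A, hA⟩ : ∃ A : ℕ, ∀ a ≥ A, 100 * Emax ≤ (a : ℝ) ^ ((b : ℝ) * β) ∧ 2 ≤ a := by
    refine eventually_atTop.1 ?_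
    filter_upwards [E1, eventually_ge_atTop 2] with a h1 h2
    exact ⟨h1, h2⟩
  set a : ℕ := NΛ * max A a₀ with ha_def
  have hmax : max A a₀ ≤ a := Nat.le_mul_of_pos_left _ hNΛ
  obtain ⟨h_E, h_2⟩ := hA a ((le_max_left _ _).trans hmax)
  have ha1 : 1 ≤ a := le_trans one_le_two h_2
  have hstep := ha₀ a ((le_max_right _ _).trans hmax) (dvd_mul_right _ _)
  have hδ1 : ∀ t ∈ Icc 0 T, e t ≤ amp β a b 1 / 100 := fun t ht => by
    rw [amp_one_eq ha1]
    linarith [hEmax t ht]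
  -- Step 1: the zero stage and the iteration
  let S₀ : BVStage ν T e εR β a b 0 :=
    { v := fun _ _ => 0
      p := fun _ _ => 0
      R := fun _ _ _ => 0
      nsr := Torus.isNSReynoldsOn_zero (Icc 0 T) ν
      mean := fun t _ => by simp [Torus.HasZeroMean]
      c1v := c1xtLE_zero (by positivity)
      l1R := fun t _ => by
        have h0 : (fun (_ : Fin 3) => (0 : ℝ³)) = 0 := rfl
        simp only [h0, norm_zero, integral_zero]
        exact mul_nonneg (Real.rpow_nonneg (Nat.cast_nonneg _) _) (amp_pos β ha1 b _).le
      c1R := c1xtLE_zero (by positivity)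
      energy := fun t ht => by
        simp only [norm_zero, ne_eq, OfNat.ofNat_ne_zero, not_false_eq_true, zero_pow,
          integral_zero, sub_zero, zero_add]
        exact ⟨he0 t ht, (hδ1 t ht).trans (by linarith [amp_pos β ha1 b 1])⟩
      zeroR := fun _ _ _ _ => rfl }
  have stepE : ∀ q (S : BVStage ν T e εR β a b q), ∃ S' : BVStage ν T e εR β a b (q + 1),
      ∀ t ∈ Icc 0 T, eLpNorm (S'.v t - S.v t) 2 volume ≤
        ENNReal.ofReal (M * amp β a b (q + 1) ^ (1 / 2 : ℝ)) := by
    intro q S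
    obtain ⟨v', p', R', h1, h2, h3, h4, h5, h6, h7, h8⟩ :=
      hstep q S.v S.p S.R S.nsr S.mean S.c1v S.l1R S.c1R S.energy S.zeroR
    exact ⟨⟨v', p', R', h1, h2, h3, h4, h5, h6, h7⟩, h8⟩
  choose stepF hstepF using stepE
  let S : ∀ q, BVStage ν T e εR β a b q := BVStage.iterate S₀ stepF
  set vq : ℕ → ℝ → 𝕋³ → ℝ³ := fun q => (S q).v with hvq
  have hvq0 : vq 0 = fun _ _ => 0 := rfl
  have hincr : ∀ q, ∀ t ∈ Icc 0 T, eLpNorm (vq (q + 1) t - vq q t) 2 volume ≤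
      ENNReal.ofReal (M * amp β a b (q + 1) ^ (1 / 2 : ℝ)) := fun q t ht =>
    hstepF q (S q) t ht
  -- Step 2: regularity and bounds of the stages
  have hsm : ∀ q, Torus.IsSmoothSpaceTimeOn (Icc 0 T) (vq q) := fun q => (S q).nsr.smooth_velocity
  have hslice : ∀ q, ∀ t ∈ Icc 0 T, Torus.IsSmooth (vq q t) := fun q t ht =>
    (hsm q).isSmooth_slice ht
  have hcont : ∀ q, ∀ t ∈ Icc 0 T, Continuous (vq q t) := fun q t ht => (hslice q t ht).continuous
  have hmeas_slice : ∀ q, ∀ t ∈ Icc 0 T, AEStronglyMeasurable (vq q t) volume := fun q t ht =>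
    (hcont q t ht).aestronglyMeasurable
  have hint_c : ∀ q, ∀ t ∈ Icc 0 T, Integrable (EuclideanSpace.complexify ∘ vq q t) volume :=
    fun q t ht => integrable_complexify_comp (hcont q t ht).integrable_unitAddTorus
  have hbounds : ∀ q, ∃ (B₀ : ℝ) (B₁ : Fin 3 → ℝ), 0 ≤ B₀ ∧ (∀ i, 0 ≤ B₁ i) ∧
      B₀ + ∑ i, B₁ i ≤ (freq a b q : ℝ) ^ 4 ∧ (∀ t ∈ Icc 0 T, ∀ x, ‖vq q t x‖ ≤ B₀) ∧
      ∀ i, ∀ t ∈ Icc 0 T, ∀ x, ‖Torus.partialDeriv i (vq q t) x‖ ≤ B₁ i := fun q =>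
    c1xtLE_bounds (S q).c1v hT.le
  choose B₀ B₁ hB₀0 hB₁0 hBsum hB₀ hB₁ using hbounds
  have haR : (1 : ℝ) < a := by exact_mod_cast lt_of_lt_of_le one_lt_two h_2
  -- Step 3: the increments are summable in `L²` and in `H^{β'}`
  set L1r : ℝ := (freq a b 1 : ℝ) with hL1r
  have hL1r1 : 1 ≤ L1r := one_le_freq_real ha1 b 1
  set ε : ℕ → ℝ≥0∞ := fun n => ENNReal.ofReal (M * amp β a b (n + 1) ^ (1 / 2 : ℝ)) with hε
  have hε_eq : ∀ n, ε n = ENNReal.ofReal ((M * L1r ^ (3 * β / 2)) * (freq a b (n + 1) : ℝ) ^ (-β)) :=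
    fun n => by
      simp only [hε]
      rw [amp_rpow_half, mul_assoc]
  have hsumε : ∑' n, ε n ≠ ⊤ := by
    simp_rw [hε_eq]
    exact tsum_ofReal_mul_freq_rpow_neg_ne_top h_2 hb2 hβ _ 1
  set tailε : ℕ → ℝ≥0∞ := fun q => ∑' i, ε (q + i) with htailε_def
  have htailε_ne : ∀ q, tailε q ≠ ⊤ := fun q =>
    ne_top_of_le_ne_top hsumε (ENNReal.tsum_comp_le_tsum_of_injective (add_right_injective q) _)
  have htailε : Tendsto tailε atTop (𝓝 0) := by
    refine (ENNReal.tendsto_sum_nat_add ε hsumε).congr fun q => ?_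
    exact tsum_congr fun i => by rw [add_comm]
  set KH : ℝ := M ^ (1 - β') * 2 ^ β' * L1r ^ (3 * β / 2 * (1 - β')) with hKH
  set H : ℕ → ℝ≥0∞ := fun n => ENNReal.ofReal (KH * (freq a b (n + 1) : ℝ) ^ (-γ)) with hH
  have hsumH : ∑' n, H n ≠ ⊤ := tsum_ofReal_mul_freq_rpow_neg_ne_top h_2 hb2 hγ0 _ 1
  set tailH : ℕ → ℝ≥0∞ := fun q => ∑' i, H (q + i) with htailH_def
  have htailH : Tendsto tailH atTop (𝓝 0) := by
    refine (ENNReal.tendsto_sum_nat_add H hsumH).congr fun q => ?_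
    exact tsum_congr fun i => by rw [add_comm]
  -- the complexified fields
  set cvq : ℕ → ℝ → 𝕋³ → EuclideanSpace ℂ (Fin 3) := fun q t => EuclideanSpace.complexify ∘ vq q t
    with hcvq
  have hHincr : ∀ n, ∀ t ∈ Icc 0 T, Torus.eSobolevNorm β' (cvq (n + 1) t - cvq n t) ≤ H n := by
    intro n t ht
    have hdsm : Torus.IsSmooth (vq (n + 1) t - vq n t) := (hslice (n + 1) t ht).sub (hslice n t ht)
    have hcs : cvq (n + 1) t - cvq n t = EuclideanSpace.complexify ∘ (vq (n + 1) t - vq n t) := by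
      rw [hcvq, complexify_comp_sub]
    rw [hcs]
    -- the `L²` factor
    have h0 : Torus.eSobolevNorm 0 (EuclideanSpace.complexify ∘ (vq (n + 1) t - vq n t)) ≤ ε n := by
      rw [Torus.eSobolevNorm_zero_eq_eLpNorm_holds
        (integrable_complexify_comp hdsm.continuous.integrable_unitAddTorus)]
      have h1 : eLpNorm (EuclideanSpace.complexify ∘ (vq (n + 1) t - vq n t)) 2 volume =
          eLpNorm (vq (n + 1) t - vq n t) 2 volume :=
        eLpNorm_congr_norm_ae (Eventually.of_forall fun x => by
          simp only [Function.comp_apply, EuclideanSpace.norm_complexify])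
      rw [h1]
      exact hincr n t ht
    -- the `H¹` factor
    have h1 : Torus.eSobolevNorm 1 (EuclideanSpace.complexify ∘ (vq (n + 1) t - vq n t)) ≤
        ENNReal.ofReal (2 * (freq a b (n + 1) : ℝ) ^ 4) := by
      refine (eSobolevNorm_one_complexify_le_of_bounds hdsm (B₀ := B₀ (n + 1) + B₀ n)
        (B₁ := fun i => B₁ (n + 1) i + B₁ n i) (fun x => ?_) (fun i x => ?_)).trans
        (ENNReal.ofReal_le_ofReal ?_)
      · exact (norm_sub_le _ _).trans (add_le_add (hB₀ (n + 1) t ht x) (hB₀ n t ht x))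
      · rw [partialDeriv_sub ((hslice (n + 1) t ht).isContDiff (by simp))
          ((hslice n t ht).isContDiff (by simp))]
        exact (norm_sub_le _ _).trans (add_le_add (hB₁ (n + 1) i t ht x) (hB₁ n i t ht x))
      · rw [Finset.sum_add_distrib]
        have hmono : (freq a b n : ℝ) ^ 4 ≤ (freq a b (n + 1) : ℝ) ^ 4 :=
          pow_le_pow_left₀ (Nat.cast_nonneg _) (freq_le_freq_succ ha1 (by omega) n) 4
        linarith [hBsum (n + 1), hBsum n]
    calc Torus.eSobolevNorm β' (EuclideanSpace.complexify ∘ (vq (n + 1) t - vq n t))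
        ≤ Torus.eSobolevNorm 0 (EuclideanSpace.complexify ∘ (vq (n + 1) t - vq n t)) ^ (1 - β') *
            Torus.eSobolevNorm 1 (EuclideanSpace.complexify ∘ (vq (n + 1) t - vq n t)) ^ β' :=
          eSobolevNorm_le_interpolate hβ'0.le hβ'1 _
      _ ≤ ε n ^ (1 - β') * ENNReal.ofReal (2 * (freq a b (n + 1) : ℝ) ^ 4) ^ β' :=
          mul_le_mul' (ENNReal.rpow_le_rpow h0 (by linarith)) (ENNReal.rpow_le_rpow h1 hβ'0.le)
      _ = H n := by
          simp only [hε, hH]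
          rw [increment_rpow_eq ha1 hM.le hβ'0.le hβ'1]
  -- Step 4: the limit field
  set wq : ℕ → ℝ → 𝕋³ → ℝ³ := fun q t x => vq q (projIcc 0 T hT.le t) x with hwq
  have hwq_eq : ∀ q, ∀ t ∈ Icc 0 T, wq q t = vq q t := fun q t ht => by
    funext x
    simp only [hwq, projIcc_of_mem hT.le ht]
  have hwq_cont : ∀ q, Continuous (uncurry (wq q)) := fun q =>
    continuous_uncurry_clamp_of_continuousOn hT.le (hsm q).continuousOn_stLift
  have hwq_cont' : ∀ q t, Continuous (wq q t) := fun q t =>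
    (hwq_cont q).comp (continuous_const.prodMk continuous_id)
  set v : ℝ → 𝕋³ → ℝ³ := fun t x => limUnder atTop (fun q => wq q t x) with hv
  have hv_sm : StronglyMeasurable (uncurry v) :=
    StronglyMeasurable.limUnder (l := atTop) (f := fun q z => uncurry (wq q) z)
      fun q => (hwq_cont q).stronglyMeasurable
  have hv_slice_sm : ∀ t, StronglyMeasurable (v t) := fun t =>
    StronglyMeasurable.limUnder (l := atTop) (f := fun q x => wq q t x)
      fun q => (hwq_cont' q t).stronglyMeasurable
  have hv_meas : ∀ t, AEStronglyMeasurable (v t) volume := fun t => (hv_slice_sm t).aestronglyMeasurable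
  -- `L²` tail bounds of the limit
  have hL2tail : ∀ q, ∀ t ∈ Icc 0 T, eLpNorm (v t - vq q t) 2 volume ≤ tailε q := by
    intro q t ht
    have h := eLpNorm_limUnder_sub_le_tsum (μ := (volume : Measure 𝕋³)) (w := fun n => wq n t)
      (ε := ε) (fun n => (hwq_cont' n t).aestronglyMeasurable)
      (fun n => by
        show eLpNorm (wq (n + 1) t - wq n t) 2 volume ≤ ε n
        rw [hwq_eq _ t ht, hwq_eq _ t ht]
        exact hincr n t ht) hsumε q
    have hfun : (fun x => limUnder atTop (fun n => wq n t x) - wq q t x) = v t - vq q t := by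
      funext x
      simp only [hv, Pi.sub_apply, hwq_eq q t ht]
    rw [hfun] at h
    exact h
  have hvL2 : ∀ t ∈ Icc 0 T, eLpNorm (v t) 2 volume ≤ tailε 0 := fun t ht => by
    have h := hL2tail 0 t ht
    have hfun : v t - vq 0 t = v t := by
      funext x
      simp [hvq0]
    rwa [hfun] at h
  have hvL2' : ∀ t ∈ Icc 0 T, eLpNorm (v t) 2 volume < ⊤ := fun t ht =>
    lt_of_le_of_lt (hvL2 t ht) (lt_top_iff_ne_top.2 (htailε_ne 0))
  have hv_memLp : ∀ t ∈ Icc 0 T, MemLp (v t) 2 volume := fun t ht => ⟨hv_meas t, hvL2' t ht⟩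
  have hv_int : ∀ t ∈ Icc 0 T, Integrable (v t) volume := fun t ht =>
    (hv_memLp t ht).integrable one_le_two
  -- `L¹` convergence of the slices
  have hL1 : ∀ t ∈ Icc 0 T, Tendsto (fun n => ∫ x, ‖vq n t x - v t x‖) atTop (𝓝 0) := by
    intro t ht
    have hb : ∀ n, ∫ x, ‖vq n t x - v t x‖ ≤ (tailε n).toReal := fun n => by
      have h1 : ∫ x, ‖vq n t x - v t x‖ = ∫ x, ‖(v t - vq n t) x‖ :=
        integral_congr_ae (ae_of_all _ fun x => by simp [norm_sub_rev])
      rw [h1]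
      exact (integral_norm_le_toReal_eLpNorm_two ((hv_meas t).sub (hmeas_slice n t ht))
        (ne_top_of_le_ne_top (htailε_ne n) (hL2tail n t ht))).trans
        (ENNReal.toReal_mono (htailε_ne n) (hL2tail n t ht))
    refine squeeze_zero (fun n => integral_nonneg fun x => norm_nonneg _) hb ?_
    have h := (ENNReal.tendsto_toReal ENNReal.zero_ne_top).comp htailε
    rwa [ENNReal.toReal_zero] at h
  -- Step 5: the four properties of the limit
  refine ⟨v, ?_, ?_, ?_, ?_⟩
  · ---------------------------------------------------------------- weak solution
    refine isWeakNSSolutionOn_of_tendsto_L2_of_defect (useq := vq) (fun m => ?_) (fun m => ?_)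
      (fun m => ?_) (fun ψ hψ hdiv => ?_) ?_ ?_ ?_
    · exact (hsm m).aestronglyMeasurable_stLift measurableSet_Ioo Ioo_subset_Icc_self
    · have hb : ∀ t ∈ Ioo 0 T, ∫⁻ x, ‖vq m t x‖ₑ ^ 2 ≤ ENNReal.ofReal (B₀ m) ^ 2 := fun t ht => by
        calc ∫⁻ x, ‖vq m t x‖ₑ ^ 2 ≤ ∫⁻ _ : 𝕋³, ENNReal.ofReal (B₀ m) ^ 2 :=
              lintegral_mono fun x => by
                rw [← ofReal_norm]
                exact pow_le_pow_left' (ENNReal.ofReal_le_ofReal (hB₀ m t (Ioo_subset_Icc_self ht) x)) 2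
          _ = ENNReal.ofReal (B₀ m) ^ 2 := by simp
      calc ∫⁻ t in Ioo 0 T, ∫⁻ x, ‖vq m t x‖ₑ ^ 2 ≤ ∫⁻ _ in Ioo 0 T, ENNReal.ofReal (B₀ m) ^ 2 :=
            setLIntegral_mono' measurableSet_Ioo hb
        _ < ⊤ := by
            rw [setLIntegral_const]
            exact ENNReal.mul_lt_top (ENNReal.pow_lt_top ENNReal.ofReal_lt_top) measure_Ioo_lt_top
    · filter_upwards [ae_restrict_mem measurableSet_Ioo] with t ht
      exact Torus.IsDivFree.isWeaklyDivFree_holds (hslice m t (Ioo_subset_Icc_self ht))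
        ((S m).nsr.divFree t (Ioo_subset_Icc_self ht))
    · -- the defect: `∫∫ ∑ⱼ ⟪R̊_m^{(j)}, ∂ⱼψ⟫ → 0`
      obtain ⟨Cψ, hCψ0, hCψ⟩ := hψ.isSpaceTimeTest.exists_bound_sum_partialDeriv isCompact_Icc
        (K := Icc 0 T)
      have hid : ∀ m, (∫ t in Ioo 0 T, ∫ x, (⟪vq m t x, Torus.timeDeriv ψ t x⟫_ℝ +
          ⟪vq m t x, Torus.convect (vq m t) (ψ t) x⟫_ℝ + ν * ⟪vq m t x, Torus.laplacian (ψ t) x⟫_ℝ)) =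
          ∫ t in Ioo 0 T, ∫ x, ∑ j, ⟪(S m).R t x j, Torus.partialDeriv j (ψ t) x⟫_ℝ := fun m => by
        have h := (S m).nsr.weak_identity subset_rfl hT hψ.isSpaceTimeTest hdiv
        rw [hψ.apply_zero] at h
        simpa using h
      have hRb : ∀ m, ‖∫ t in Ioo 0 T, ∫ x, ∑ j, ⟪(S m).R t x j, Torus.partialDeriv j (ψ t) x⟫_ℝ‖ ≤
          (Cψ * ((freq a b m : ℝ) ^ (-εR) * amp β a b (m + 1))) * (volume (Ioo (0 : ℝ) T)).toReal :=
        fun m => by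
        refine norm_setIntegral_le_of_norm_le_const measure_Ioo_lt_top (fun t ht => ?_)
        have htI : t ∈ Icc 0 T := Ioo_subset_Icc_self ht
        have hRsm : Torus.IsSmooth ((S m).R t) := (S m).nsr.smooth_stress.isSmooth_slice htI
        have hpt : ∀ x, ‖∑ j, ⟪(S m).R t x j, Torus.partialDeriv j (ψ t) x⟫_ℝ‖ ≤ Cψ * ‖(S m).R t x‖ :=
          fun x => by
          calc ‖∑ j, ⟪(S m).R t x j, Torus.partialDeriv j (ψ t) x⟫_ℝ‖
              ≤ ∑ j, ‖⟪(S m).R t x j, Torus.partialDeriv j (ψ t) x⟫_ℝ‖ := norm_sum_le _ _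
            _ ≤ ∑ j, ‖(S m).R t x‖ * ‖Torus.partialDeriv j (ψ t) x‖ :=
                Finset.sum_le_sum fun j _ => (norm_inner_le_norm _ _).trans
                  (mul_le_mul_of_nonneg_right (norm_le_pi_norm ((S m).R t x) j) (norm_nonneg _))
            _ = ‖(S m).R t x‖ * ∑ j, ‖Torus.partialDeriv j (ψ t) x‖ := (Finset.mul_sum _ _ _).symm
            _ ≤ ‖(S m).R t x‖ * Cψ := mul_le_mul_of_nonneg_left (hCψ t htI x) (norm_nonneg _)
            _ = Cψ * ‖(S m).R t x‖ := mul_comm _ _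
        calc ‖∫ x, ∑ j, ⟪(S m).R t x j, Torus.partialDeriv j (ψ t) x⟫_ℝ‖
            ≤ ∫ x, Cψ * ‖(S m).R t x‖ :=
              norm_integral_le_of_norm_le ((hRsm.continuous.norm).integrable_unitAddTorus.const_mul Cψ)
                (ae_of_all _ hpt)
          _ = Cψ * ∫ x, ‖(S m).R t x‖ := integral_const_mul _ _
          _ ≤ Cψ * ((freq a b m : ℝ) ^ (-εR) * amp β a b (m + 1)) :=
              mul_le_mul_of_nonneg_left ((S m).l1R t htI) hCψ0
      -- the bound tends to zero
      have hgeo : Tendsto (fun m : ℕ => ((a : ℝ) ^ (-εR)) ^ m) atTop (𝓝 0) :=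
        tendsto_pow_atTop_nhds_zero_of_lt_one (Real.rpow_nonneg (Nat.cast_nonneg _) _)
          (Real.rpow_lt_one_of_one_lt_of_neg haR (by linarith))
      have hdom : ∀ m, (freq a b m : ℝ) ^ (-εR) * amp β a b (m + 1) ≤
          ((a : ℝ) ^ (-εR)) ^ m * L1r ^ (3 * β) := fun m => by
        have hamp : amp β a b (m + 1) ≤ L1r ^ (3 * β) := by
          rw [amp]
          refine mul_le_of_le_one_right (Real.rpow_nonneg (Nat.cast_nonneg _) _) ?_
          exact Real.rpow_le_one_of_one_le_of_nonpos (one_le_freq_real ha1 b _) (by linarith)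
        exact mul_le_mul (freq_rpow_neg_le_pow ha1 hb2 hεR.le m) hamp (amp_pos β ha1 b _).le
          (pow_nonneg (Real.rpow_nonneg (Nat.cast_nonneg _) _) m)
      have hbound0 : Tendsto (fun m => (Cψ * (((a : ℝ) ^ (-εR)) ^ m * L1r ^ (3 * β))) *
          (volume (Ioo (0 : ℝ) T)).toReal) atTop (𝓝 0) := by
        have h := ((hgeo.mul_const (L1r ^ (3 * β))).const_mul Cψ).mul_const
          (volume (Ioo (0 : ℝ) T)).toReal
        simpa using h
      rw [show (fun m => ∫ t in Ioo 0 T, ∫ x, (⟪vq m t x, Torus.timeDeriv ψ t x⟫_ℝ +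
          ⟪vq m t x, Torus.convect (vq m t) (ψ t) x⟫_ℝ + ν * ⟪vq m t x, Torus.laplacian (ψ t) x⟫_ℝ)) =
          fun m => ∫ t in Ioo 0 T, ∫ x, ∑ j, ⟪(S m).R t x j, Torus.partialDeriv j (ψ t) x⟫_ℝ from
        funext hid]
      refine squeeze_zero_norm (fun m => (hRb m).trans ?_) hbound0
      exact mul_le_mul_of_nonneg_right (mul_le_mul_of_nonneg_left (hdom m) hCψ0) ENNReal.toReal_nonneg
    · exact Torus.aestronglyMeasurable_stLift_of_uncurry (S := Ioo 0 T) hv_sm.aestronglyMeasurable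
    · calc ∫⁻ t in Ioo 0 T, ∫⁻ x, ‖v t x‖ₑ ^ 2 ≤ ∫⁻ _ in Ioo 0 T, tailε 0 ^ 2 :=
            setLIntegral_mono' measurableSet_Ioo fun t ht => by
              rw [← eLpNorm_two_sq_eq_lintegral]
              exact pow_le_pow_left' (hvL2 t (Ioo_subset_Icc_self ht)) 2
        _ < ⊤ := by
            rw [setLIntegral_const]
            exact ENNReal.mul_lt_top (ENNReal.pow_lt_top (lt_top_iff_ne_top.2 (htailε_ne 0)))
              measure_Ioo_lt_top
    · have hb : ∀ m, ∫⁻ t in Ioo 0 T, ∫⁻ x, ‖vq m t x - v t x‖ₑ ^ 2 ≤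
          volume (Ioo (0 : ℝ) T) * tailε m ^ 2 := fun m => by
        calc ∫⁻ t in Ioo 0 T, ∫⁻ x, ‖vq m t x - v t x‖ₑ ^ 2 ≤ ∫⁻ _ in Ioo 0 T, tailε m ^ 2 :=
              setLIntegral_mono' measurableSet_Ioo fun t ht => by
                change ∫⁻ x, ‖(vq m t - v t) x‖ₑ ^ 2 ≤ _
                rw [← eLpNorm_two_sq_eq_lintegral, eLpNorm_sub_comm]
                exact pow_le_pow_left' (hL2tail m t (Ioo_subset_Icc_self ht)) 2
          _ = volume (Ioo (0 : ℝ) T) * tailε m ^ 2 := by rw [setLIntegral_const, mul_comm]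
      have h0 : Tendsto (fun m => volume (Ioo (0 : ℝ) T) * tailε m ^ 2) atTop (𝓝 0) := by
        have h := ENNReal.Tendsto.const_mul (ENNReal.Tendsto.pow (n := 2) htailε)
          (Or.inr measure_Ioo_lt_top.ne) (a := volume (Ioo (0 : ℝ) T))
        simpa using h
      exact tendsto_of_tendsto_of_tendsto_of_le_of_le tendsto_const_nhds h0 (fun _ => zero_le) hb
  · ---------------------------------------------------------------- zero mean
    intro t ht
    have hlim : Tendsto (fun q => ∫ x, vq q t x) atTop (𝓝 (∫ x, v t x)) := by
      refine tendsto_integral_of_L1 _ (hv_meas t)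
        (Eventually.of_forall fun q => (hcont q t ht).integrable_unitAddTorus) ?_
      refine tendsto_of_tendsto_of_tendsto_of_le_of_le tendsto_const_nhds htailε
        (fun q => zero_le) (fun q => ?_)
      calc ∫⁻ x, ‖vq q t x - v t x‖ₑ = eLpNorm (vq q t - v t) 1 volume := by
            rw [eLpNorm_one_eq_lintegral_enorm]; rfl
        _ ≤ eLpNorm (vq q t - v t) 2 volume := by
            simpa using eLpNorm_le_eLpNorm_mul_rpow_measure_univ (p := 1) (q := 2)
              (μ := (volume : Measure 𝕋³)) (by norm_num)
              ((hmeas_slice q t ht).sub (hv_meas t))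
        _ = eLpNorm (v t - vq q t) 2 volume := eLpNorm_sub_comm _ _ _ _
        _ ≤ tailε q := hL2tail q t ht
    have hzero : ∀ q, ∫ x, vq q t x = 0 := fun q => (S q).mean t ht
    simp only [hzero] at hlim
    exact tendsto_nhds_unique hlim tendsto_const_nhds
  · ---------------------------------------------------------------- `C⁰_t H^{β'}_x`
    set cv : ℝ → 𝕋³ → EuclideanSpace ℂ (Fin 3) := fun t => EuclideanSpace.complexify ∘ v t with hcv
    have hint_cv : ∀ t ∈ Icc 0 T, Integrable (cv t) volume := fun t ht =>
      integrable_complexify_comp (hv_int t ht)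
    have hHtail : ∀ q, ∀ t ∈ Icc 0 T, Torus.eSobolevNorm β' (cv t - cvq q t) ≤ tailH q := by
      intro q t ht
      refine eSobolevNorm_le_of_tendsto (f := fun n => cvq (q + n) t - cvq q t) (g := cv t - cvq q t)
        (fun n => (hint_c _ t ht).sub (hint_c _ t ht)) ((hint_cv t ht).sub (hint_c q t ht)) ?_
        (fun n => ?_)
      · have h1 : ∀ n, ∫ x, ‖(cvq (q + n) t - cvq q t) x - (cv t - cvq q t) x‖ =
            ∫ x, ‖vq (q + n) t x - v t x‖ := fun n =>
          integral_congr_ae (ae_of_all _ fun x => by simp [hcvq, hcv, ← map_sub])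
        simp_rw [h1]
        exact (hL1 t ht).comp ((tendsto_add_atTop_nat q).congr fun n => add_comm n q)
      · calc Torus.eSobolevNorm β' (cvq (q + n) t - cvq q t) ≤ ∑ i ∈ Finset.range n, H (q + i) :=
              eSobolevNorm_sub_le_sum_of_le (g := fun k => cvq k t) (fun k => hint_c k t ht)
                (fun k => hHincr k t ht) q n
          _ ≤ tailH q := ENNReal.sum_le_tsum _
    have hcvq0 : ∀ t, cvq 0 t = 0 := fun t => by
      funext x
      simp [hcvq, hvq0]
    have hmemS : ∀ t ∈ Icc 0 T, Torus.MemSobolev β' (cv t) := fun t ht => by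
      refine ⟨hint_cv t ht, ?_⟩
      calc Torus.eSobolevNorm β' (cv t) = Torus.eSobolevNorm β' (cv t - cvq 0 t) := by
            rw [hcvq0, sub_zero]
        _ ≤ tailH 0 := hHtail 0 t ht
        _ < ⊤ := by
            refine lt_top_iff_ne_top.2 (ne_top_of_le_ne_top hsumH ?_)
            exact ENNReal.tsum_comp_le_tsum_of_injective (add_right_injective 0) _
    refine ⟨hmemS, fun t₀ ht₀ => ?_⟩
    rw [ENNReal.tendsto_nhds_zero]
    intro δ hδ
    have hδ3 : 0 < δ / 3 := ENNReal.div_pos hδ.ne' (by norm_num)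
    obtain ⟨q, hq⟩ : ∃ q, tailH q ≤ δ / 3 := ((ENNReal.tendsto_nhds_zero.1 htailH) (δ / 3) hδ3).exists
    -- a real `η > 0` with `4η ≤ δ/3`
    obtain ⟨η, hη0, hη⟩ : ∃ η : ℝ, 0 < η ∧ ENNReal.ofReal (4 * η) ≤ δ / 3 := by
      obtain ⟨r, hr0, hr⟩ := exists_between hδ3
      have hrtop : r ≠ ⊤ := ne_top_of_lt hr
      refine ⟨r.toReal / 4, div_pos (ENNReal.toReal_pos hr0.ne' hrtop) four_pos, ?_⟩
      rw [show 4 * (r.toReal / 4) = r.toReal by ring, ENNReal.ofReal_toReal hrtop]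
      exact hr.le
    have hq_cont : ∀ᶠ s in 𝓝[Icc 0 T] t₀, Torus.eSobolevNorm β' (cvq q s - cvq q t₀) ≤ δ / 3 := by
      have e0 := (hsm q).eventually_norm_sub_lt ht₀ hη0
      have e1 : ∀ i, ∀ᶠ s in 𝓝[Icc 0 T] t₀, ∀ x,
          ‖Torus.partialDeriv i (vq q s) x - Torus.partialDeriv i (vq q t₀) x‖ < η := fun i =>
        ((hsm q).partialDeriv (uniqueDiffOn_Icc hT) i).eventually_norm_sub_lt ht₀ hη0
      have e1' : ∀ᶠ s in 𝓝[Icc 0 T] t₀, ∀ i x,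
          ‖Torus.partialDeriv i (vq q s) x - Torus.partialDeriv i (vq q t₀) x‖ < η :=
        eventually_all.2 e1
      filter_upwards [e0, e1', eventually_mem_nhdsWithin] with s hs0 hs1 hsI
      have hdsm : Torus.IsSmooth (vq q s - vq q t₀) := (hslice q s hsI).sub (hslice q t₀ ht₀)
      have hcs : cvq q s - cvq q t₀ = EuclideanSpace.complexify ∘ (vq q s - vq q t₀) := by
        rw [hcvq, complexify_comp_sub]
      rw [hcs]
      calc Torus.eSobolevNorm β' (EuclideanSpace.complexify ∘ (vq q s - vq q t₀))
          ≤ Torus.eSobolevNorm 1 (EuclideanSpace.complexify ∘ (vq q s - vq q t₀)) :=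
            Torus.eSobolevNorm_mono hβ'1 _
        _ ≤ ENNReal.ofReal (η + ∑ _i : Fin 3, η) :=
            eSobolevNorm_one_complexify_le_of_bounds hdsm (fun x => (hs0 x).le) (fun i x => by
              rw [partialDeriv_sub ((hslice q s hsI).isContDiff (by simp))
                ((hslice q t₀ ht₀).isContDiff (by simp))]
              exact (hs1 i x).le)
        _ = ENNReal.ofReal (4 * η) := by
            congr 1
            simp only [Finset.sum_const, Finset.card_univ, Fintype.card_fin]
            ring
        _ ≤ δ / 3 := hη
    filter_upwards [hq_cont, eventually_mem_nhdsWithin] with t hqt htI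
    have i1 : Integrable (cv t - cvq q t) volume := (hint_cv t htI).sub (hint_c q t htI)
    have i2 : Integrable (cvq q t - cvq q t₀) volume := (hint_c q t htI).sub (hint_c q t₀ ht₀)
    have i3 : Integrable (cvq q t₀ - cv t₀) volume := (hint_c q t₀ ht₀).sub (hint_cv t₀ ht₀)
    have hsplit : cv t - cv t₀ = ((cv t - cvq q t) + (cvq q t - cvq q t₀)) + (cvq q t₀ - cv t₀) := by
      abel
    have h3 : Torus.eSobolevNorm β' (cvq q t₀ - cv t₀) ≤ δ / 3 := by
      rw [← neg_sub, Torus.eSobolevNorm_neg]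
      exact (hHtail q t₀ ht₀).trans hq
    have h12 : Torus.eSobolevNorm β' ((cv t - cvq q t) + (cvq q t - cvq q t₀)) ≤
        Torus.eSobolevNorm β' (cv t - cvq q t) + Torus.eSobolevNorm β' (cvq q t - cvq q t₀) :=
      Torus.eSobolevNorm_add_le_holds i1 i2
    show Torus.eSobolevNorm β' (cv t - cv t₀) ≤ δ
    calc Torus.eSobolevNorm β' (cv t - cv t₀)
        = Torus.eSobolevNorm β' (((cv t - cvq q t) + (cvq q t - cvq q t₀)) + (cvq q t₀ - cv t₀)) :=
          congrArg (Torus.eSobolevNorm β') hsplit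
      _ ≤ Torus.eSobolevNorm β' ((cv t - cvq q t) + (cvq q t - cvq q t₀)) +
            Torus.eSobolevNorm β' (cvq q t₀ - cv t₀) :=
          Torus.eSobolevNorm_add_le_holds (i1.add i2) i3
      _ ≤ (Torus.eSobolevNorm β' (cv t - cvq q t) + Torus.eSobolevNorm β' (cvq q t - cvq q t₀)) +
            Torus.eSobolevNorm β' (cvq q t₀ - cv t₀) :=
          add_le_add h12 le_rfl
      _ ≤ (δ / 3 + δ / 3) + δ / 3 := add_le_add (add_le_add ((hHtail q t htI).trans hq) hqt) h3
      _ = δ := ENNReal.add_thirds δ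
  · ---------------------------------------------------------------- the energy profile
    intro t ht
    have hfin : eLpNorm (v t) 2 volume ≠ ⊤ := (hvL2' t ht).ne
    have hd : Tendsto (fun q => eLpNorm (v t - vq q t) 2 volume) atTop (𝓝 0) :=
      tendsto_of_tendsto_of_tendsto_of_le_of_le tendsto_const_nhds htailε (fun q => zero_le)
        fun q => hL2tail q t ht
    have hconvN : Tendsto (fun q => eLpNorm (vq q t) 2 volume) atTop (𝓝 (eLpNorm (v t) 2 volume)) := by
      have hup : ∀ q, eLpNorm (vq q t) 2 volume ≤ eLpNorm (v t) 2 volume + eLpNorm (v t - vq q t) 2 volume :=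
        fun q => by
        calc eLpNorm (vq q t) 2 volume = eLpNorm (v t - (v t - vq q t)) 2 volume := by rw [sub_sub_cancel]
          _ ≤ _ := eLpNorm_sub_le (hv_meas t) ((hv_meas t).sub (hmeas_slice q t ht)) one_le_two
      have hlow : ∀ q, eLpNorm (v t) 2 volume ≤ eLpNorm (vq q t) 2 volume + eLpNorm (v t - vq q t) 2 volume :=
        fun q => by
        calc eLpNorm (v t) 2 volume = eLpNorm (vq q t + (v t - vq q t)) 2 volume := by rw [add_sub_cancel]
          _ ≤ _ := eLpNorm_add_le (hmeas_slice q t ht) ((hv_meas t).sub (hmeas_slice q t ht)) one_le_two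
      refine tendsto_of_le_liminf_of_limsup_le ?_ ?_
      · have h1 : Tendsto (fun q => eLpNorm (v t) 2 volume - eLpNorm (v t - vq q t) 2 volume) atTop
            (𝓝 (eLpNorm (v t) 2 volume - 0)) := ENNReal.Tendsto.sub tendsto_const_nhds hd (Or.inl hfin)
        rw [tsub_zero] at h1
        calc eLpNorm (v t) 2 volume
            = liminf (fun q => eLpNorm (v t) 2 volume - eLpNorm (v t - vq q t) 2 volume) atTop :=
              h1.liminf_eq.symm
          _ ≤ liminf (fun q => eLpNorm (vq q t) 2 volume) atTop :=
              liminf_le_liminf (Eventually.of_forall fun q => tsub_le_iff_right.2 (hlow q))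
      · have h1 : Tendsto (fun q => eLpNorm (v t) 2 volume + eLpNorm (v t - vq q t) 2 volume) atTop
            (𝓝 (eLpNorm (v t) 2 volume + 0)) := tendsto_const_nhds.add hd
        rw [add_zero] at h1
        calc limsup (fun q => eLpNorm (vq q t) 2 volume) atTop
            ≤ limsup (fun q => eLpNorm (v t) 2 volume + eLpNorm (v t - vq q t) 2 volume) atTop :=
              limsup_le_limsup (Eventually.of_forall hup)
          _ = eLpNorm (v t) 2 volume := h1.limsup_eq
    -- the energies of the stages converge to `e t` …
    have hδ0 : Tendsto (fun q => amp β a b (q + 1)) atTop (𝓝 0) := by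
      have hgeo : Tendsto (fun m : ℕ => ((a : ℝ) ^ (-(2 * β))) ^ m) atTop (𝓝 0) :=
        tendsto_pow_atTop_nhds_zero_of_lt_one (Real.rpow_nonneg (Nat.cast_nonneg _) _)
          (Real.rpow_lt_one_of_one_lt_of_neg haR (by linarith))
      have hdom : ∀ q, amp β a b (q + 1) ≤ L1r ^ (3 * β) * ((a : ℝ) ^ (-(2 * β))) ^ (q + 1) := fun q => by
        rw [amp]
        refine mul_le_mul_of_nonneg_left ?_ (Real.rpow_nonneg (Nat.cast_nonneg _) _)
        have h := freq_rpow_neg_le_pow ha1 hb2 (κ := 2 * β) (by linarith) (q + 1)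
        rwa [show -2 * β = -(2 * β) by ring]
      have h0 : Tendsto (fun q => L1r ^ (3 * β) * ((a : ℝ) ^ (-(2 * β))) ^ (q + 1)) atTop (𝓝 0) := by
        have h := (hgeo.comp (tendsto_add_atTop_nat 1)).const_mul (L1r ^ (3 * β))
        simpa using h
      exact squeeze_zero (fun q => (amp_pos β ha1 b _).le) hdom h0
    have hEq : Tendsto (fun q => ∫ x, ‖vq q t x‖ ^ 2) atTop (𝓝 (e t)) := by
      refine tendsto_of_tendsto_of_tendsto_of_le_of_le (g := fun q => e t - amp β a b (q + 1))
        (h := fun _ => e t) ?_ tendsto_const_nhds (fun q => by linarith [((S q).energy t ht).2])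
        (fun q => by linarith [((S q).energy t ht).1])
      have h : Tendsto (fun q => e t - amp β a b (q + 1)) atTop (𝓝 (e t - 0)) :=
        tendsto_const_nhds.sub hδ0
      rwa [sub_zero] at h
    -- … and to `∫ |v t|²`
    have hEq' : Tendsto (fun q => ∫ x, ‖vq q t x‖ ^ 2) atTop (𝓝 (∫ x, ‖v t x‖ ^ 2)) := by
      have h2 : Tendsto (fun q => (eLpNorm (vq q t) 2 volume ^ 2).toReal) atTop
          (𝓝 ((eLpNorm (v t) 2 volume ^ 2).toReal)) :=
        (ENNReal.tendsto_toReal (ENNReal.pow_ne_top hfin)).comp (ENNReal.Tendsto.pow hconvN)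
      rw [integral_norm_sq_eq_toReal (hv_meas t)]
      refine h2.congr fun q => ?_
      exact (integral_norm_sq_eq_toReal (hmeas_slice q t ht)).symm
    exact tendsto_nhds_unique hEq' hEq

/-- **The catalogued barrier from Prop. 2.1 alone**: `BuckmasterVicolNonuniqueness` (the in-tree
`ν`-general nonuniqueness statement of Buckmaster–Vicol 2019, Thm. 1.2) follows from the named
fact `BuckmasterVicol2019_prop21` through the proved §2.4 (`BuckmasterVicol2019_thm12_of_prop21`)
and the proved scaling step of part I (`BuckmasterVicolNonuniqueness_of_thm12`). The trust base of
the barrier is thereby reduced to Prop. 2.1 (§§3–6 of the paper).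
[cite: BuckmasterVicol2019AnnMath, Prop. 2.1 and §2.4] -/
theorem BuckmasterVicolNonuniqueness_of_prop21 (hP : BuckmasterVicol2019_prop21) :
    BuckmasterVicolNonuniqueness :=
  BuckmasterVicolNonuniqueness_of_thm12 (BuckmasterVicol2019_thm12_of_prop21 hP)

end Assembly

end Literature.Barriers.NavierStokesRegularity

end
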